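import Literature.Geometry.Riemannian.CutLocusTriangulationCarrier
import Literature.Geometry.Manifold.SubanalyticSets
import HarnessLib

/-!
# Buchner's theorem from its two theory-sized inputs: subanalyticity of the cut locus and Hironaka's triangulation

Topic `Geometry/Riemannian`; ninth support file of the programme towards the named fact
`Literature.Geometry.Riemannian.buchner1977_cutLocus_triangulable` of `CutLocus.lean`
(M. A. Buchner, *Simplicial structure of the real analytic cut locus*, Proc. AMS 64 (1977)
118–121). Buchner's proof has exactly two ingredients beyond the classical theory of the cut locus:
(S) **the cut locus of a compact real-analytic Riemannian manifold is subanalytic** (pp. 119–121,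
the content of the paper: Milnor's finite-dimensional approximation of the path space, the
characterisation `C(p) = {degenerate minimum} ∪ {two minima}` — proved in the tree's vocabulary in
`CutLocusCharacterization.lean` — and Hironaka's calculus of subanalytic sets), and
(T) **Hironaka's subanalytic triangulation theorem** ("the cut locus is subanalytic and by [2] is
triangulable", p. 121; H. Hironaka, *Triangulations of algebraic sets*, PSPM 29 (1975), §3,
Theorem p. 182: every compact subanalytic subset of `ℝⁿ` is homeomorphic to the polyhedron of a
finite simplicial complex).

This file PROVES the implication (S) ∧ (T) ⇒ `buchner1977_cutLocus_triangulable`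
(`buchner1977_cutLocus_triangulable_of_subanalytic`), with (S) and (T) as explicit HYPOTHESES
stated in the tree's vocabulary (`Literature.Geometry.Manifold.IsSubanalytic`, Hironaka 1975
Def. 3.3, `SubanalyticSets.lean`; Mathlib `Geometry.SimplicialComplex`). Neither is vendored as a
named fact (D-0026: this seat mints no facts); the theorem pins down the exact formal shape a
future vendoring of Hironaka's triangulation theorem must have to close the fact, the dimension
clause and the Euclidean carrier being already disposed of
(`buchner1977_cutLocus_triangulable_of_homeomorph_pi`, `CutLocusTriangulationCarrier.lean`,
`CutLocusDimension.lean`). Since the statement of the fact concerns an ABSTRACT compact analytic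
manifold, (S) is phrased through a continuous injection `ι : M → ℝᴺ` under which the image of the
cut locus is subanalytic (Buchner embeds nothing — he works with subanalytic subsets of the
analytic manifold `M`; an analytic embedding `M ↪ ℝᴺ` exists by Grauert–Morrey, and images of
relatively compact subanalytic sets under analytic maps are subanalytic, Hironaka's Prop. II), and
includes the classical closedness of the cut locus (Lee 2018, Thm. 10.34 (a)), needed to make the
image compact.

* `homeomorph_image_of_continuous_injective` — a continuous injection restricts to a
  homeomorphism from a compact subset onto its image in a Hausdorff space;
* `buchner1977_cutLocus_triangulable_of_subanalytic` — the reduction.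

## References

* [Buchner1977Simplicial] M. A. Buchner, Proc. AMS 64 (1977), pp. 118–121.
* [Hironaka1975] H. Hironaka, Triangulations of algebraic sets, PSPM 29 (1975), §3, Theorem
  (subanalytic triangulation), p. 182 of the volume.
-/

noncomputable section

open Set Function
open scoped Manifold ContDiff Topology

namespace Literature.Geometry.Riemannian

open Literature.Geometry.Lorentzian (PseudoRiemannianMetric)
open Literature.Geometry.Manifold (IsSubanalytic)

/-- **A continuous injection restricts to a homeomorphism from a compact set onto its image** in a
Hausdorff space (continuous bijection from a compact space to a Hausdorff space). [folklore] -/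
theorem homeomorph_image_of_continuous_injective {X Y : Type*} [TopologicalSpace X]
    [TopologicalSpace Y] [T2Space Y] {ι : X → Y} (hι : Continuous ι) (hinj : Injective ι)
    {C : Set X} (hC : IsCompact C) : Nonempty (C ≃ₜ ι '' C) := by
  haveI : CompactSpace C := isCompact_iff_compactSpace.1 hC
  let e : C ≃ ι '' C := Equiv.Set.image ι C hinj
  have he : Continuous e := (hι.comp continuous_subtype_val).subtype_mk _
  exact ⟨he.homeoOfEquivCompactToT2 (f := e)⟩

universe u v w

/-- **Buchner's theorem from (S) the subanalyticity of the cut locus and (T) Hironaka's subanalytic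
triangulation theorem.** Hypotheses, both classical theorems NOT in the tree:
(T) every compact subanalytic subset of some `ℝᴺ` (`Fin N → ℝ`; `IsSubanalytic` = Hironaka 1975,
Def. 3.3) is homeomorphic to the polyhedron of a finite simplicial complex in some `ℝⁿ` (Hironaka
1975, §3, Theorem; [2] of Buchner); (S) for every compact connected Hausdorff boundaryless
real-analytic Riemannian manifold `(M, g)` and `p ∈ M` the cut locus of `p` is closed and there is
a continuous injection `ι : M → ℝᴺ` with `ι(cutLocus p)` subanalytic (Buchner 1977, pp. 119–121,
with an analytic embedding of `M`). Conclusion: `buchner1977_cutLocus_triangulable` — the cut locus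
is compact, `ι` restricts to a homeomorphism onto the compact subanalytic set `ι(cutLocus p)`, which
(T) triangulates; carrier and dimension clause by
`buchner1977_cutLocus_triangulable_of_homeomorph_pi`. [cite: Buchner1977Simplicial, p. 121] -/
theorem buchner1977_cutLocus_triangulable_of_subanalytic
    (hT : ∀ (N : ℕ) (X : Set (Fin N → ℝ)), IsSubanalytic X → IsCompact X →
      ∃ (n : ℕ) (K : Geometry.SimplicialComplex ℝ (Fin n → ℝ)),
        K.faces.Finite ∧ Nonempty (X ≃ₜ K.space))
    (hS : ∀ {E : Type u} [NormedAddCommGroup E] [NormedSpace ℝ E] [FiniteDimensional ℝ E]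
      {H : Type v} [TopologicalSpace H] (I : ModelWithCorners ℝ E H) [I.Boundaryless]
      {M : Type w} [TopologicalSpace M] [ChartedSpace H M] [IsManifold I ω M]
      [CompactSpace M] [T2Space M] [ConnectedSpace M]
      (g : PseudoRiemannianMetric I ω E (TangentSpace I : M → Type _)) (hg : g.IsRiemannian)
      (p : M),
      IsClosed (cutLocus g hg p) ∧ ∃ (N : ℕ) (ι : M → (Fin N → ℝ)),
        Continuous ι ∧ Injective ι ∧ IsSubanalytic (ι '' cutLocus g hg p)) :
    buchner1977_cutLocus_triangulable.{u, v, w} := by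
  refine buchner1977_cutLocus_triangulable_of_homeomorph_pi ?_
  intro E _ _ _ H _ I _ M _ _ _ _ _ _ g hg p
  obtain ⟨hclosed, N, ι, hι, hinj, hsub⟩ := hS I g hg p
  have hC : IsCompact (cutLocus g hg p) := hclosed.isCompact
  obtain ⟨e₁⟩ := homeomorph_image_of_continuous_injective hι hinj hC
  obtain ⟨n, K, hfin, ⟨e₂⟩⟩ := hT N _ hsub (hC.image hι)
  exact ⟨n, K, hfin, ⟨e₁.trans e₂⟩⟩

end Literature.Geometry.Riemannian

end
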